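import Summits.Ventures.PercRepro.C041ZoneZReach

/-!
# THEOREM Z — the three steps as involutions of the state type (p6, gen 27; C-041.md §12 (d)–(g), (k))

Setting of `C041ZoneZReach`; `Q` the protected anchors (`∅` or `{c}`), `A` the anchors.  The three maps of the
proof, each a dual / complement OUTSIDE a region computed from the state itself:

* `psi Q σ := dual (P Q σ) σ` — STEP 2: complement outside the protected sub-zones and swap the `1`-patterns there;
* `chi Q A σ := dual (C ∪ P) σ` with `C := Cmix Q A σ` the mixed reach of the anchors — STEP 3;
* `phi Q σ := flipOut (D ∪ P) σ` — STEP 1: complement outside the deleted vertices and the protected sub-zones.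

Because each region is preserved by its own map (AGREEMENT, `C041ZoneZReach`), every map is an INVOLUTION of the
state type (`psi_psi`, `chi_chi`, `phi_phi`), hence injective — no fibres and no conditioning are needed.  The
membership transfers: `psi` carries `Κ = {adm ∧ blueK ∧ Γ}` into `K2` (`psi_mem`: the blue reach of the blockers
becomes a red reach outside `P`, the red reach of the anchors becomes the mixed reach, and the `1`-marks outside `P`
are exchanged); `chi` carries `K2` into `P2 = {adm ∧ Disjoint C (Bl ∪ Mt) ∧ Γ}` (`chi_mem`: a blue path of the image
from a blocker stays outside `C ∪ P`, where it is a red path of the state from a red-marked vertex); `phi` carries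
`P2` into `Ρ′ = {adm ∧ ¬anchorDel ∧ reach2 ∧ Γ}` (`phi_mem`: `C ∩ D = ∅` when `C` misses the blockers
(`disjoint_Cmix_D`), and the red reach of the image inside the non-deleted vertices lies in `C`).
-/

namespace PercRepro

namespace ZoneZ

namespace ZoneData

variable {V E T₁ T₂ : Type*} (Z : ZoneData V E T₁ T₂) (Q A : Set V)

/-! ## The three maps and their involution property -/

/-- STEP 2: the dual outside the protected sub-zones. -/
noncomputable def psi (σ : State E T₁ T₂) : State E T₁ T₂ := Z.dual (Z.P Q σ) σ

/-- STEP 3: the dual outside the mixed reach of the anchors and the protected sub-zones. -/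
noncomputable def chi (σ : State E T₁ T₂) : State E T₁ T₂ := Z.dual (Z.Cmix Q A σ ∪ Z.P Q σ) σ

/-- STEP 1: the complement outside the deleted vertices and the protected sub-zones. -/
noncomputable def phi (σ : State E T₁ T₂) : State E T₁ T₂ := Z.flipOut (Z.D σ ∪ Z.P Q σ) σ

/-- `psi` preserves `P`. -/
theorem P_psi (σ : State E T₁ T₂) : Z.P Q (Z.psi Q σ) = Z.P Q σ :=
  Z.P_dual_eq Q _ σ (le_refl _)

/-- `psi` is an involution. -/
theorem psi_psi (σ : State E T₁ T₂) : Z.psi Q (Z.psi Q σ) = σ := by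
  unfold psi
  rw [Z.P_dual_eq Q _ σ (le_refl _), Z.dual_dual]

/-- `chi` preserves `P`. -/
theorem P_chi (σ : State E T₁ T₂) : Z.P Q (Z.chi Q A σ) = Z.P Q σ :=
  Z.P_dual_eq Q _ σ Set.subset_union_right

/-- `chi` preserves `C`. -/
theorem Cmix_chi (σ : State E T₁ T₂) : Z.Cmix Q A (Z.chi Q A σ) = Z.Cmix Q A σ :=
  Z.Cmix_dual_eq Q A _ σ Set.subset_union_right Set.subset_union_left

/-- `chi` is an involution. -/
theorem chi_chi (σ : State E T₁ T₂) : Z.chi Q A (Z.chi Q A σ) = σ := by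
  have h1 := Z.P_chi Q A σ
  have h2 := Z.Cmix_chi Q A σ
  unfold chi at h1 h2 ⊢
  rw [h1, h2, Z.dual_dual]

/-- `phi` preserves `P`. -/
theorem P_phi (σ : State E T₁ T₂) : Z.P Q (Z.phi Q σ) = Z.P Q σ :=
  Z.P_flipOut_eq Q _ σ Set.subset_union_right

/-- `phi` preserves `D`. -/
theorem D_phi (σ : State E T₁ T₂) : Z.D (Z.phi Q σ) = Z.D σ :=
  Z.D_flipOut_eq _ σ Set.subset_union_left

/-- `phi` is an involution. -/
theorem phi_phi (σ : State E T₁ T₂) : Z.phi Q (Z.phi Q σ) = σ := by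
  have h1 := Z.P_phi Q σ
  have h2 := Z.D_phi Q σ
  unfold phi at h1 h2 ⊢
  rw [h1, h2, Z.flipOut_flipOut]

/-- `psi` is injective. -/
theorem psi_injective : Function.Injective (Z.psi Q) := injective_of_involutive _ (Z.psi_psi Q)

/-- `chi` is injective. -/
theorem chi_injective : Function.Injective (Z.chi Q A) := injective_of_involutive _ (Z.chi_chi Q A)

/-- `phi` is injective. -/
theorem phi_injective : Function.Injective (Z.phi Q) := injective_of_involutive _ (Z.phi_phi Q)

/-! ## `Γ` is preserved by a dual outside a set containing `P` -/

/-- A dual outside a set containing `P` preserves `Γ` (the marks on `P` are unchanged). -/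
theorem gam_dual (X : Set V) (σ : State E T₁ T₂) (hX : Z.P Q σ ⊆ X) (hΓ : Z.Gam Q σ) :
    Z.Gam Q (Z.dual X σ) := by
  unfold Gam
  rw [Z.P_dual_eq Q X σ hX, Z.M_dual]
  rw [Set.disjoint_left]
  intro v hvP hv
  refine Set.disjoint_left.1 hΓ hvP ?_
  rcases hv with hv | hv
  · exact Or.inl ((Z.mem_Bl_dual_of_mem X σ (hX hvP)).1 hv)
  · exact Or.inr hv

/-- A complement outside a set containing `P` preserves `Γ`. -/
theorem gam_flipOut (X : Set V) (σ : State E T₁ T₂) (hX : Z.P Q σ ⊆ X) (hΓ : Z.Gam Q σ) :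
    Z.Gam Q (Z.flipOut X σ) := by
  unfold Gam
  rw [Z.P_flipOut_eq Q X σ hX, Z.M_flipOut, Z.Bl_flipOut]
  exact hΓ

/-! ## STEP 2 -/

/-- Two pointwise-equivalent adjacencies have the same reach. -/
theorem reach_congr {R R' : V → V → Prop} (h : ∀ u v, R u v ↔ R' u v) (S : Set V) : reach R S = reach R' S :=
  Set.Subset.antisymm (reach_mono (fun u v hr => (h u v).1 hr) le_rfl)
    (reach_mono (fun u v hr => (h u v).2 hr) le_rfl)

/-- The mixed reach of the anchors in `psi σ` is the red reach of the anchors in `σ`. -/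
theorem Cmix_psi (σ : State E T₁ T₂) : Z.Cmix Q A (Z.psi Q σ) = Z.K A σ := by
  unfold Cmix K
  rw [Z.P_psi Q σ]
  exact reach_congr (Z.mixedAdj_dual_iff (Z.P Q σ) σ) A

/-- The red reach outside `P` of the red-marked vertices of `psi σ` lies in the deleted set of `σ`. -/
theorem reachIn_psi_subset_D (σ : State E T₁ T₂) :
    reachIn (Z.RedAdj (Z.psi Q σ)) (Z.P Q (Z.psi Q σ))ᶜ (Z.Blt (Z.psi Q σ)) ⊆ Z.D σ := by
  rw [Z.P_psi Q σ]
  unfold reachIn D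
  apply reach_mono
  · rintro u v ⟨h, hu, hv⟩
    exact (Z.redAdj_dual_iff (Z.P Q σ) σ hu hv).1 h
  · rintro v ⟨hv, hvP⟩
    exact (Z.mem_Blt_dual_of_not_mem (Z.P Q σ) σ hvP).1 hv

/-- **STEP 2**: `psi` carries `{adm ∧ blueK ∧ Γ}` into `K2`. -/
theorem psi_mem (σ : State E T₁ T₂) (hadm : Z.adm σ) (hK : Z.blueK A σ) (hΓ : Z.Gam Q σ) :
    Disjoint (Z.M (Z.psi Q σ)) (reachIn (Z.RedAdj (Z.psi Q σ)) (Z.P Q (Z.psi Q σ))ᶜ (Z.Blt (Z.psi Q σ))) ∧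
      Disjoint (Z.Cmix Q A (Z.psi Q σ))
        (Z.Bl (Z.psi Q σ) ∪ Z.Mt (Z.psi Q σ) ∪ (Z.Blt (Z.psi Q σ) ∩ Z.P Q (Z.psi Q σ))) ∧
      Z.Gam Q (Z.psi Q σ) := by
  refine ⟨?_, ?_, Z.gam_dual Q _ σ (le_refl _) hΓ⟩
  · have hM : Z.M (Z.psi Q σ) = Z.M σ := Z.M_dual _ σ
    rw [hM]
    exact Set.disjoint_of_subset_right (Z.reachIn_psi_subset_D Q σ) hadm
  · rw [Z.Cmix_psi Q A σ, Z.P_psi Q σ]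
    have hMt : Z.Mt (Z.psi Q σ) = Z.Mt σ := Z.Mt_dual _ σ
    rw [hMt, Set.disjoint_left]
    intro v hvK hv
    rcases hv with (hv | hv) | ⟨hv, hvP⟩
    · by_cases hvP : v ∈ Z.P Q σ
      · exact Set.disjoint_left.1 hΓ hvP (Or.inl ((Z.mem_Bl_dual_of_mem _ σ hvP).1 hv))
      · exact Set.disjoint_left.1 hK hvK (Or.inl ((Z.mem_Bl_dual_of_not_mem _ σ hvP).1 hv))
    · exact Set.disjoint_left.1 hK hvK (Or.inr hv)
    · exact Set.disjoint_left.1 hK hvK (Or.inl ((Z.mem_Blt_dual_of_mem _ σ hvP).1 hv))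

/-! ## STEP 3 -/

/-- The complement of `C ∪ P` is closed under the blue adjacency of `chi σ`: a blue edge of the image leaving it would
be an unchanged blue edge of `σ` entering `P` or `C` from outside. -/
theorem not_mem_union_of_blueAdj_chi (σ : State E T₁ T₂) {u v : V} (hu : u ∉ Z.Cmix Q A σ ∪ Z.P Q σ)
    (h : Z.BlueAdj (Z.chi Q A σ) u v) : v ∉ Z.Cmix Q A σ ∪ Z.P Q σ := by
  intro hv
  obtain ⟨e, hj, hc⟩ := h
  have ht : Z.Touches (Z.Cmix Q A σ ∪ Z.P Q σ) e := Z.touches_of_joins_left hj.symm hv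
  rw [chi, Z.dual_fst_of_touches _ σ ht] at hc
  have hblue : Z.BlueAdj σ v u := ⟨e, hj.symm, hc⟩
  have huP : u ∉ Z.P Q σ := fun h' => hu (Or.inr h')
  have huC : u ∉ Z.Cmix Q A σ := fun h' => hu (Or.inl h')
  rcases hv with hvC | hvP
  · by_cases hvP : v ∈ Z.P Q σ
    · exact huP (Z.blue_closed_P Q σ v u hvP hblue)
    · exact huC (reach_tail hvC (Z.mixedAdj_of_blueAdj_of_not_touches hblue hvP huP))
  · exact huP (Z.blue_closed_P Q σ v u hvP hblue)

/-- The blockers of `chi σ` lie outside `C ∪ P` and are red-marked in `σ`. -/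
theorem Bl_chi_subset (σ : State E T₁ T₂) (hC : Disjoint (Z.Cmix Q A σ) (Z.Bl σ)) (hΓ : Z.Gam Q σ) :
    Z.Bl (Z.chi Q A σ) ⊆ Z.Blt σ ∩ (Z.Cmix Q A σ ∪ Z.P Q σ)ᶜ := by
  intro v hv
  have hvX : v ∉ Z.Cmix Q A σ ∪ Z.P Q σ := by
    intro hvX
    have hvBl : v ∈ Z.Bl σ := (Z.mem_Bl_dual_of_mem _ σ hvX).1 hv
    rcases hvX with hvC | hvP
    · exact Set.disjoint_left.1 hC hvC hvBl
    · exact Set.disjoint_left.1 hΓ hvP (Or.inl hvBl)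
  exact ⟨(Z.mem_Bl_dual_of_not_mem _ σ hvX).1 hv, hvX⟩

/-- The deleted set of `chi σ` lies in the red reach outside `P` of the red-marked vertices of `σ`. -/
theorem D_chi_subset (σ : State E T₁ T₂) (hC : Disjoint (Z.Cmix Q A σ) (Z.Bl σ)) (hΓ : Z.Gam Q σ) :
    Z.D (Z.chi Q A σ) ⊆ reachIn (Z.RedAdj σ) (Z.P Q σ)ᶜ (Z.Blt σ) := by
  have hBl := Z.Bl_chi_subset Q A σ hC hΓ
  have h1 : Z.D (Z.chi Q A σ) ⊆
      reachIn (Z.BlueAdj (Z.chi Q A σ)) (Z.Cmix Q A σ ∪ Z.P Q σ)ᶜ (Z.Bl (Z.chi Q A σ)) :=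
    reach_subset_reachIn_of_closed (fun v hv => (hBl hv).2)
      (fun u v hu h => Z.not_mem_union_of_blueAdj_chi Q A σ hu h)
  have h2 : reachIn (Z.BlueAdj (Z.chi Q A σ)) (Z.Cmix Q A σ ∪ Z.P Q σ)ᶜ (Z.Bl (Z.chi Q A σ)) ⊆
      reachIn (Z.RedAdj σ) (Z.Cmix Q A σ ∪ Z.P Q σ)ᶜ (Z.Blt σ) := by
    apply reach_mono
    · rintro u v ⟨h, hu, hv⟩
      exact ⟨(Z.blueAdj_dual_iff _ σ hu hv).1 h, hu, hv⟩
    · rintro v ⟨hv, hvX⟩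
      exact ⟨(hBl hv).1, hvX⟩
  have h3 : reachIn (Z.RedAdj σ) (Z.Cmix Q A σ ∪ Z.P Q σ)ᶜ (Z.Blt σ) ⊆
      reachIn (Z.RedAdj σ) (Z.P Q σ)ᶜ (Z.Blt σ) :=
    reachIn_mono (Set.compl_subset_compl.2 Set.subset_union_right) le_rfl
  exact h1.trans (h2.trans h3)

/-- **STEP 3**: `chi` carries `K2` into `P2`. -/
theorem chi_mem (σ : State E T₁ T₂)
    (h1 : Disjoint (Z.M σ) (reachIn (Z.RedAdj σ) (Z.P Q σ)ᶜ (Z.Blt σ)))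
    (h2 : Disjoint (Z.Cmix Q A σ) (Z.Bl σ ∪ Z.Mt σ ∪ (Z.Blt σ ∩ Z.P Q σ))) (hΓ : Z.Gam Q σ) :
    Z.adm (Z.chi Q A σ) ∧ Disjoint (Z.Cmix Q A (Z.chi Q A σ)) (Z.Bl (Z.chi Q A σ) ∪ Z.Mt (Z.chi Q A σ)) ∧
      Z.Gam Q (Z.chi Q A σ) := by
  have hC : Disjoint (Z.Cmix Q A σ) (Z.Bl σ) :=
    Set.disjoint_of_subset_right (Set.subset_union_left.trans Set.subset_union_left) h2
  refine ⟨?_, ?_, Z.gam_dual Q _ σ Set.subset_union_right hΓ⟩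
  · unfold adm
    have hM : Z.M (Z.chi Q A σ) = Z.M σ := Z.M_dual _ σ
    rw [hM]
    exact Set.disjoint_of_subset_right (Z.D_chi_subset Q A σ hC hΓ) h1
  · rw [Z.Cmix_chi Q A σ]
    have hMt : Z.Mt (Z.chi Q A σ) = Z.Mt σ := Z.Mt_dual _ σ
    rw [hMt, Set.disjoint_left]
    intro v hvC hv
    rcases hv with hv | hv
    · exact Set.disjoint_left.1 h2 hvC (Or.inl (Or.inl ((Z.mem_Bl_dual_of_mem _ σ (Or.inl hvC)).1 hv)))
    · exact Set.disjoint_left.1 h2 hvC (Or.inl (Or.inr hv))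

/-! ## STEP 1 -/

/-- When the mixed reach of the anchors misses the blockers it misses the deleted vertices: a blue path from a
vertex of `C ∩ D` back to its blocker stays outside `P`, hence inside `C`. -/
theorem disjoint_Cmix_D (σ : State E T₁ T₂) (hC : Disjoint (Z.Cmix Q A σ) (Z.Bl σ)) (hΓ : Z.Gam Q σ) :
    Disjoint (Z.Cmix Q A σ) (Z.D σ) := by
  rw [Set.disjoint_left]
  intro v hvC hvD
  have hPD := Z.disjoint_P_D Q σ hΓ
  obtain ⟨w, hw, hwv⟩ := exists_mem_reach_of_mem_reach (Z.adj_symm _ σ) hvD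
  have hsub : reach (Z.BlueAdj σ) {v} ⊆ Z.Cmix Q A σ ∩ (Z.P Q σ)ᶜ := by
    apply reach_subset_of_closed
    · intro x hx
      rw [Set.mem_singleton_iff] at hx
      subst hx
      exact ⟨hvC, fun hvP => Set.disjoint_left.1 hPD hvP hvD⟩
    · rintro x y ⟨hxC, hxP⟩ h
      have hyP : y ∉ Z.P Q σ := Z.not_mem_P_of_blueAdj Q σ hxP h
      exact ⟨reach_tail hxC (Z.mixedAdj_of_blueAdj_of_not_touches h hxP hyP), hyP⟩
  exact Set.disjoint_left.1 hC (hsub hwv).1 hw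

/-- The red reach of `phi σ` inside the non-deleted vertices lies in the mixed reach `C` of `σ`. -/
theorem reachIn_phi_subset_Cmix (σ : State E T₁ T₂) :
    reachIn (Z.RedAdj (Z.phi Q σ)) (Z.D (Z.phi Q σ))ᶜ A ⊆ Z.Cmix Q A σ := by
  rw [Z.D_phi Q σ]
  apply reach_subset_of_closed
  · exact Set.inter_subset_left.trans subset_reach
  · rintro u v huC ⟨⟨e, hj, hc⟩, hu, hv⟩
    by_cases ht : Z.Touches (Z.P Q σ) e
    · rw [phi, Z.flipOut_fst_of_touches _ σ (Z.touches_mono Set.subset_union_right ht)] at hc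
      exact reach_tail huC ⟨e, hj, Or.inl ⟨ht, hc⟩⟩
    · have ht' : ¬ Z.Touches (Z.D σ ∪ Z.P Q σ) e := by
        rintro (h | h) <;> rcases h with h | h
        · exact (Z.not_touches_of_joins hj hu hv) (Or.inl h)
        · exact ht (Or.inl h)
        · exact (Z.not_touches_of_joins hj hu hv) (Or.inr h)
        · exact ht (Or.inr h)
      rw [phi, Z.flipOut_fst_of_not_touches _ σ ht'] at hc
      have hblue : σ.1 e = false := by
        cases h : σ.1 e
        · rfl
        · rw [h] at hc
          exact absurd hc (by decide)
      exact reach_tail huC ⟨e, hj, Or.inr ⟨ht, hblue⟩⟩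

/-- **STEP 1**: `phi` carries `P2` into `{adm ∧ ¬anchorDel ∧ reach2 ∧ Γ}`. -/
theorem phi_mem (σ : State E T₁ T₂) (hadm : Z.adm σ) (hC : Disjoint (Z.Cmix Q A σ) (Z.Bl σ ∪ Z.Mt σ))
    (hΓ : Z.Gam Q σ) :
    Z.adm (Z.phi Q σ) ∧ ¬ Z.anchorDel A (Z.phi Q σ) ∧ Z.reach2 A (Z.phi Q σ) ∧ Z.Gam Q (Z.phi Q σ) := by
  have hCD : Disjoint (Z.Cmix Q A σ) (Z.D σ) :=
    Z.disjoint_Cmix_D Q A σ (Set.disjoint_of_subset_right Set.subset_union_left hC) hΓ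
  refine ⟨?_, ?_, ?_, Z.gam_flipOut Q _ σ Set.subset_union_right hΓ⟩
  · unfold adm
    rw [Z.D_phi Q σ]
    exact hadm
  · unfold anchorDel
    rw [Z.D_phi Q σ]
    rintro ⟨v, hvA, hvD⟩
    exact Set.disjoint_left.1 hCD (subset_reach hvA) hvD
  · unfold reach2 REACH
    have hMt : Z.Mt (Z.phi Q σ) = Z.Mt σ := Z.Mt_flipOut _ σ
    rw [hMt]
    exact Set.disjoint_of_subset_left (Z.reachIn_phi_subset_Cmix Q A σ)
      (Set.disjoint_of_subset_right Set.subset_union_right hC)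

end ZoneData

end ZoneZ

end PercRepro
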